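import Literature.Computability.FineGrained.IPRenameOccTable
import HarnessLib

/-!
# The renaming machine of Impagliazzo–Paturi's Lemma 2, XIII: the dictionary of a mask

Family `fine-grained` (trunk T-CPLX-FINE). Thirteenth file of the machine half of Impagliazzo–Paturi's Lemma 2. For a mask `bs` (a
compile-time list of Booleans; `P.mask = maskOf bs`) the side of an occurring variable is
`inB P F x = light ∧ bs[col x]`; the dictionary gives every occurring variable its annotated
literal without the polarity bit (`dpay`; `bit_cons_dpay : bit p :: dpay P F x =
wALit (annLit P F (x, p))`): tag `A` with the rank `newIdxA` in binary, or tag `B` with block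
number `blockOf` and position `posIn` in unary.

* `maskTest bs` (the mask baked into the program), `decideB`, `emitA` (rank counter `na`,
  `incrG`), `emitB` (block counter in `sat`, position counter in `posc`, wrapped at `m = bsz P` by
  `wrapPos`), `dictBody`, `dictBuild bs m`;
* counting along `occList` (`cntA`, `cntB`, `idxOf_filter_eq`, `blockOf_next`, `posIn_next`,
  `newIdxA_next`), the pass (`segRuns_d_*`), and **`runs_dictBuild`**:
  `dict := wRecs (dictRecs P F (occList F))`, cost `dictCost`.

## References

* R. Impagliazzo, R. Paturi, *On the complexity of k-SAT*, J. Comput. System Sci. 62 (2001)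
  367–375, doi:10.1006/jcss.2000.1727, Lemma 2 (p. 373) and its "Moreover" sentence (the
  reduction is computable within the stated time); pp. 371–372 (`G_x`, `Ψ`, `Θ_i`, `Φ_f`).
  (Not held; acquisition request acq-00143.)
* T. Nipkow, G. Klein, *Concrete Semantics with Isabelle/HOL*, Springer 2014, Ch. 7 (big-step
  reasoning about loops, as in `SymbolPrograms.lean`).
-/

namespace Literature.Computability.FineGrained.IPRenameM

open _root_.Computability Complexity Complexity.ACom Sparsifier IPRename
open Compaction (uflag uflag_true uflag_false)

/-! ### The dictionary of a mask: programs -/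

/-- `maskTest bs`: with the colour `col` as kets in `c` (consumed), raise `u3` iff
`bs.getD col false`; the mask is baked into the program. [folklore] -/
def maskTest : List Bool → RProg
  | [] => clear (kr KR.c)
  | b :: bs => pop (kr KR.c) fun o => match o with
      | some _ => maskTest bs
      | none => if b then push (kr KR.u3) Γ'.blank else skip

/-- Decide `inB`: light (flag `fl`, consumed) and selected by the mask. [folklore] -/
def decideB (bs : List Bool) : RProg :=
  pop (kr KR.fl) fun o => match o with
    | some _ => maskTest bs
    | none => clear (kr KR.c)

/-- After incrementing the position counter: if it reached the block length `m`, reset it and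
increment the block counter. [folklore] -/
def popN : ℕ → RProg
  | 0 => clear (kr KR.s6) ;; clear (kr KR.posc) ;; push (kr KR.sat) Γ'.ket
  | n + 1 => pop (kr KR.s6) fun o => match o with
      | some _ => popN n
      | none => skip

/-- Wrap the position counter at `m`. [folklore] -/
def wrapPos (m : ℕ) : RProg := copyToG (kr KR.posc) (kr KR.s6) (kr KR.t1) (kr KR.t2) ;; popN m

/-- Emit the payload of a `B`-variable (block number kets, position bras) and advance the
counters. [folklore] -/
def emitB (m : ℕ) : RProg :=
  push (kr KR.dict2) (Γ'.bit true) ;;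
  copyToG (kr KR.sat) (kr KR.s6) (kr KR.t1) (kr KR.t2) ;; loop (kr KR.s6) (fun s => push (kr KR.dict2) s) ;;
  copyToG (kr KR.posc) (kr KR.s6) (kr KR.t1) (kr KR.t2) ;; loop (kr KR.s6) (fun _ => push (kr KR.dict2) Γ'.bra) ;;
  push (kr KR.dict2) Γ'.comma ;; push (kr KR.dict2) Γ'.blank ;; push (kr KR.posc) Γ'.blank ;; wrapPos m

/-- Emit the payload of an `A`-variable (its rank, in binary) and advance the rank counter.
[folklore] -/
def emitA : RProg :=
  push (kr KR.dict2) (Γ'.bit false) ;;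
  copyToG (kr KR.na) (kr KR.s6) (kr KR.t1) (kr KR.t2) ;; loop (kr KR.s6) (fun s => push (kr KR.dict2) s) ;;
  push (kr KR.dict2) Γ'.comma ;; push (kr KR.dict2) Γ'.blank ;; incrG (kr KR.na) (kr KR.fl2) (kr KR.s7)

/-- At the blank closing an occurrence record. [folklore] -/
def recEnd (bs : List Bool) (m : ℕ) : RProg :=
  decideB bs ;; pop (kr KR.u3) fun o => match o with
    | some _ => emitB m
    | none => emitA

/-- Body of the dictionary builder over the copy `oc2` of the occurrence table (mode `md`: empty =
key bits, copied to the output; `comma` = payload: light flag, colour kets, closing blank).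
[folklore] -/
def dictBody (bs : List Bool) (m : ℕ) (s : Γ') : RProg :=
  pop (kr KR.md) fun o => match o, s with
    | none, Γ'.bit d => push (kr KR.dict2) (Γ'.bit d)
    | none, Γ'.comma => push (kr KR.dict2) Γ'.comma ;; push (kr KR.md) Γ'.comma
    | none, _ => skip
    | some _, Γ'.bit true => push (kr KR.fl) Γ'.blank ;; push (kr KR.md) Γ'.comma
    | some _, Γ'.ket => push (kr KR.c) Γ'.ket ;; push (kr KR.md) Γ'.comma
    | some _, Γ'.blank => recEnd bs m
    | some _, _ => push (kr KR.md) Γ'.comma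

/-- **`dictBuild bs m`**: from the occurrence table, the dictionary of the mask `bs`: for every
occurring variable its tag (`A`/`B`) and payload (rank in binary / block and position in unary),
i.e. the word of its annotated literal without the polarity bit. The rank counter `na` is left at
`|aList|`, the first new index of the renaming variables. [folklore] -/
def dictBuild (bs : List Bool) (m : ℕ) : RProg :=
  copyToG (kr KR.oc) (kr KR.oc2) (kr KR.t1) (kr KR.t2) ;; loop (kr KR.oc2) (dictBody bs m) ;; pour (kr KR.dict2) (kr KR.dict) ;;
  clear (kr KR.sat) ;; clear (kr KR.posc)

/-! ### Functional description -/

/-- The dictionary payload of an occurring variable: its annotated literal without the polarity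
bit. [folklore] -/
def dpay (P : Params) (F : List (List (ℕ × Bool))) (x : ℕ) : List Γ' :=
  if inB P F x then Γ'.bit true :: (List.replicate (blockOf P F x) Γ'.ket ++ List.replicate (posIn P F x) Γ'.bra ++ [Γ'.comma])
  else Γ'.bit false :: ((encodeNat (newIdxA P F x)).map Γ'.bit ++ [Γ'.comma])

/-- The dictionary of a list of variables. [folklore] -/
def dictRecs (P : Params) (F : List (List (ℕ × Bool))) (zs : List ℕ) : List (ℕ × List Γ') := zs.map fun x => (x, dpay P F x)

/-- **The dictionary payload is the annotated literal.** [folklore] -/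
theorem bit_cons_dpay (P : Params) (F : List (List (ℕ × Bool))) (x : ℕ) (p : Bool) :
    Γ'.bit p :: dpay P F x = wALit (annLit P F (x, p)) := by
  unfold dpay annLit
  by_cases h : inB P F x = true
  · rw [if_pos h, if_pos h]; rfl
  · rw [if_neg h, if_neg h]; rfl

/-- The store family `dSt` over a base store. [folklore] -/
def dSt (S : RStore) (oc2 md dict2 fl c u3 na sat posc s6 : List Γ') : RStore := fun r =>
  if r = kr KR.oc2 then oc2 else if r = kr KR.md then md else if r = kr KR.dict2 then dict2 else if r = kr KR.fl then fl else if r = kr KR.c then c else if r = kr KR.u3 then u3 else if r = kr KR.na then na else if r = kr KR.sat then sat else if r = kr KR.posc then posc else if r = kr KR.s6 then s6 else S r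

section DstLemmas

variable (S : RStore) (oc2 md dict2 fl c u3 na sat posc s6 w : List Γ')

/-- Reading `oc2`. [folklore] -/
@[simp] theorem dSt_oc2 : dSt S oc2 md dict2 fl c u3 na sat posc s6 (kr KR.oc2) = oc2 := by simp [dSt]
/-- Reading `md`. [folklore] -/
@[simp] theorem dSt_md : dSt S oc2 md dict2 fl c u3 na sat posc s6 (kr KR.md) = md := by simp [dSt]
/-- Reading `dict2`. [folklore] -/
@[simp] theorem dSt_dict2 : dSt S oc2 md dict2 fl c u3 na sat posc s6 (kr KR.dict2) = dict2 := by simp [dSt]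
/-- Reading `fl`. [folklore] -/
@[simp] theorem dSt_fl : dSt S oc2 md dict2 fl c u3 na sat posc s6 (kr KR.fl) = fl := by simp [dSt]
/-- Reading `c`. [folklore] -/
@[simp] theorem dSt_c : dSt S oc2 md dict2 fl c u3 na sat posc s6 (kr KR.c) = c := by simp [dSt]
/-- Reading `u3`. [folklore] -/
@[simp] theorem dSt_u3 : dSt S oc2 md dict2 fl c u3 na sat posc s6 (kr KR.u3) = u3 := by simp [dSt]
/-- Reading `na`. [folklore] -/
@[simp] theorem dSt_na : dSt S oc2 md dict2 fl c u3 na sat posc s6 (kr KR.na) = na := by simp [dSt]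
/-- Reading `sat`. [folklore] -/
@[simp] theorem dSt_sat : dSt S oc2 md dict2 fl c u3 na sat posc s6 (kr KR.sat) = sat := by simp [dSt]
/-- Reading `posc`. [folklore] -/
@[simp] theorem dSt_posc : dSt S oc2 md dict2 fl c u3 na sat posc s6 (kr KR.posc) = posc := by simp [dSt]
/-- Reading `s6`. [folklore] -/
@[simp] theorem dSt_s6 : dSt S oc2 md dict2 fl c u3 na sat posc s6 (kr KR.s6) = s6 := by simp [dSt]
/-- Reading any other register. [folklore] -/
theorem dSt_other {r : Reg} (h0 : r ≠ kr KR.oc2) (h1 : r ≠ kr KR.md) (h2 : r ≠ kr KR.dict2) (h3 : r ≠ kr KR.fl) (h4 : r ≠ kr KR.c) (h5 : r ≠ kr KR.u3) (h6 : r ≠ kr KR.na) (h7 : r ≠ kr KR.sat) (h8 : r ≠ kr KR.posc) (h9 : r ≠ kr KR.s6) :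
    dSt S oc2 md dict2 fl c u3 na sat posc s6 r = S r := by simp [dSt, h0, h1, h2, h3, h4, h5, h6, h7, h8, h9]
/-- Reading `oc`. [folklore] -/
@[simp] theorem dSt_oc : dSt S oc2 md dict2 fl c u3 na sat posc s6 (kr KR.oc) = S (kr KR.oc) := by simp [dSt]
/-- Reading `t1`. [folklore] -/
@[simp] theorem dSt_t1 : dSt S oc2 md dict2 fl c u3 na sat posc s6 (kr KR.t1) = S (kr KR.t1) := by simp [dSt]
/-- Reading `t2`. [folklore] -/
@[simp] theorem dSt_t2 : dSt S oc2 md dict2 fl c u3 na sat posc s6 (kr KR.t2) = S (kr KR.t2) := by simp [dSt]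
/-- Reading `s7`. [folklore] -/
@[simp] theorem dSt_s7 : dSt S oc2 md dict2 fl c u3 na sat posc s6 (kr KR.s7) = S (kr KR.s7) := by simp [dSt]
/-- Reading `fl2`. [folklore] -/
@[simp] theorem dSt_fl2 : dSt S oc2 md dict2 fl c u3 na sat posc s6 (kr KR.fl2) = S (kr KR.fl2) := by simp [dSt]
/-- Reading `dict`. [folklore] -/
@[simp] theorem dSt_dict : dSt S oc2 md dict2 fl c u3 na sat posc s6 (kr KR.dict) = S (kr KR.dict) := by simp [dSt]
/-- Updating `oc2`. [folklore] -/
@[simp] theorem update_dSt_oc2 : Function.update (dSt S oc2 md dict2 fl c u3 na sat posc s6) (kr KR.oc2) w = dSt S w md dict2 fl c u3 na sat posc s6 := by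
  funext r; by_cases h : r = kr KR.oc2
  · subst h; simp
  · rw [Function.update_of_ne h]; simp [dSt, h]
/-- Updating `md`. [folklore] -/
@[simp] theorem update_dSt_md : Function.update (dSt S oc2 md dict2 fl c u3 na sat posc s6) (kr KR.md) w = dSt S oc2 w dict2 fl c u3 na sat posc s6 := by
  funext r; by_cases h : r = kr KR.md
  · subst h; simp
  · rw [Function.update_of_ne h]; simp [dSt, h]
/-- Updating `dict2`. [folklore] -/
@[simp] theorem update_dSt_dict2 : Function.update (dSt S oc2 md dict2 fl c u3 na sat posc s6) (kr KR.dict2) w = dSt S oc2 md w fl c u3 na sat posc s6 := by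
  funext r; by_cases h : r = kr KR.dict2
  · subst h; simp
  · rw [Function.update_of_ne h]; simp [dSt, h]
/-- Updating `fl`. [folklore] -/
@[simp] theorem update_dSt_fl : Function.update (dSt S oc2 md dict2 fl c u3 na sat posc s6) (kr KR.fl) w = dSt S oc2 md dict2 w c u3 na sat posc s6 := by
  funext r; by_cases h : r = kr KR.fl
  · subst h; simp
  · rw [Function.update_of_ne h]; simp [dSt, h]
/-- Updating `c`. [folklore] -/
@[simp] theorem update_dSt_c : Function.update (dSt S oc2 md dict2 fl c u3 na sat posc s6) (kr KR.c) w = dSt S oc2 md dict2 fl w u3 na sat posc s6 := by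
  funext r; by_cases h : r = kr KR.c
  · subst h; simp
  · rw [Function.update_of_ne h]; simp [dSt, h]
/-- Updating `u3`. [folklore] -/
@[simp] theorem update_dSt_u3 : Function.update (dSt S oc2 md dict2 fl c u3 na sat posc s6) (kr KR.u3) w = dSt S oc2 md dict2 fl c w na sat posc s6 := by
  funext r; by_cases h : r = kr KR.u3
  · subst h; simp
  · rw [Function.update_of_ne h]; simp [dSt, h]
/-- Updating `na`. [folklore] -/
@[simp] theorem update_dSt_na : Function.update (dSt S oc2 md dict2 fl c u3 na sat posc s6) (kr KR.na) w = dSt S oc2 md dict2 fl c u3 w sat posc s6 := by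
  funext r; by_cases h : r = kr KR.na
  · subst h; simp
  · rw [Function.update_of_ne h]; simp [dSt, h]
/-- Updating `sat`. [folklore] -/
@[simp] theorem update_dSt_sat : Function.update (dSt S oc2 md dict2 fl c u3 na sat posc s6) (kr KR.sat) w = dSt S oc2 md dict2 fl c u3 na w posc s6 := by
  funext r; by_cases h : r = kr KR.sat
  · subst h; simp
  · rw [Function.update_of_ne h]; simp [dSt, h]
/-- Updating `posc`. [folklore] -/
@[simp] theorem update_dSt_posc : Function.update (dSt S oc2 md dict2 fl c u3 na sat posc s6) (kr KR.posc) w = dSt S oc2 md dict2 fl c u3 na sat w s6 := by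
  funext r; by_cases h : r = kr KR.posc
  · subst h; simp
  · rw [Function.update_of_ne h]; simp [dSt, h]
/-- Updating `s6`. [folklore] -/
@[simp] theorem update_dSt_s6 : Function.update (dSt S oc2 md dict2 fl c u3 na sat posc s6) (kr KR.s6) w = dSt S oc2 md dict2 fl c u3 na sat posc w := by
  funext r; by_cases h : r = kr KR.s6
  · subst h; simp
  · rw [Function.update_of_ne h]; simp [dSt, h]

end DstLemmas

/-- Every store is a `dSt` over itself. [folklore] -/
theorem dSt_eta (R : RStore) : dSt R (R (kr KR.oc2)) (R (kr KR.md)) (R (kr KR.dict2)) (R (kr KR.fl)) (R (kr KR.c)) (R (kr KR.u3)) (R (kr KR.na)) (R (kr KR.sat)) (R (kr KR.posc)) (R (kr KR.s6)) = R := by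
  funext r
  by_cases h0 : r = kr KR.oc2; · subst h0; simp
  by_cases h1 : r = kr KR.md; · subst h1; simp
  by_cases h2 : r = kr KR.dict2; · subst h2; simp
  by_cases h3 : r = kr KR.fl; · subst h3; simp
  by_cases h4 : r = kr KR.c; · subst h4; simp
  by_cases h5 : r = kr KR.u3; · subst h5; simp
  by_cases h6 : r = kr KR.na; · subst h6; simp
  by_cases h7 : r = kr KR.sat; · subst h7; simp
  by_cases h8 : r = kr KR.posc; · subst h8; simp
  by_cases h9 : r = kr KR.s6; · subst h9; simp
  rw [dSt_other _ _ _ _ _ _ _ _ _ _ _ h0 h1 h2 h3 h4 h5 h6 h7 h8 h9]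

/-! ### The dictionary of a mask: specifications of the bricks -/

/-- The numeral of `n` as a word. [folklore] -/
abbrev bitsN (n : ℕ) : List Γ' := (encodeNat n).map Γ'.bit

section DSpec

variable (S : RStore) (ht1 : S (kr KR.t1) = []) (ht2 : S (kr KR.t2) = [])
include ht1 ht2

omit ht1 ht2 in
/-- **`maskTest`.** [folklore] -/
theorem runs_maskTest (oc2 md dict2 fl na sat posc s6 : List Γ') : ∀ (bs : List Bool) (col : ℕ),
    Runs (maskTest bs) (dSt S oc2 md dict2 fl (List.replicate col Γ'.ket) [] na sat posc s6)
      (dSt S oc2 md dict2 fl [] (uflag (bs.getD col false)) na sat posc s6) (2 * (bs.length + col) + 3)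
  | [], col => by
    unfold maskTest
    have h := runs_clear (kr KR.c) (dSt S oc2 md dict2 fl (List.replicate col Γ'.ket) [] na sat posc s6)
    rw [dSt_c, update_dSt_c, List.length_replicate] at h
    exact h.of_eq (by simp) (by simp only [List.length_nil]; omega)
  | b :: bs, 0 => by
    unfold maskTest
    rw [List.replicate_zero]
    cases b with
    | true =>
      have hin : Runs (if true = true then push (kr KR.u3) Γ'.blank else skip) (dSt S oc2 md dict2 fl [] [] na sat posc s6)
          (dSt S oc2 md dict2 fl [] (uflag ((true :: bs).getD 0 false)) na sat posc s6) 1 := by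
        rw [if_pos rfl]
        refine Runs.push' ?_
        rw [dSt_u3, update_dSt_u3]; simp
      exact (Runs.pop_nil (by simp) hin).mono (by simp)
    | false =>
      have hin : Runs (if false = true then push (kr KR.u3) Γ'.blank else skip) (dSt S oc2 md dict2 fl [] [] na sat posc s6)
          (dSt S oc2 md dict2 fl [] (uflag ((false :: bs).getD 0 false)) na sat posc s6) 0 := by
        rw [if_neg (by decide)]
        exact (Runs.skip _).of_eq (by simp) le_rfl
      exact (Runs.pop_nil (by simp) hin).mono (by simp)
  | b :: bs, col + 1 => by
    unfold maskTest
    rw [List.replicate_succ]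
    have ih := runs_maskTest oc2 md dict2 fl na sat posc s6 bs col
    have hin : Runs (maskTest bs) (Function.update (dSt S oc2 md dict2 fl (Γ'.ket :: List.replicate col Γ'.ket) [] na sat posc s6) (kr KR.c)
        (List.replicate col Γ'.ket)) (dSt S oc2 md dict2 fl [] (uflag ((b :: bs).getD (col + 1) false)) na sat posc s6) (2 * (bs.length + col) + 3) := by
      rw [update_dSt_c]; simpa using ih
    exact (Runs.pop_cons (k := kr KR.c) (a := Γ'.ket) (w := List.replicate col Γ'.ket) (by simp) hin).mono (by simp; omega)

omit ht1 ht2 in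
/-- **`decideB`**: `u3 := inB`-flag `light ∧ mask col`. [folklore] -/
theorem runs_decideB (bs : List Bool) (oc2 md dict2 na sat posc s6 : List Γ') (light : Bool) (col : ℕ) :
    Runs (decideB bs) (dSt S oc2 md dict2 (uflag light) (List.replicate col Γ'.ket) [] na sat posc s6)
      (dSt S oc2 md dict2 [] [] (uflag (light && bs.getD col false)) na sat posc s6) (2 * (bs.length + col) + 5) := by
  unfold decideB
  cases light with
  | true =>
    have h := runs_maskTest S oc2 md dict2 [] na sat posc s6 bs col
    have hin : Runs (maskTest bs) (Function.update (dSt S oc2 md dict2 (uflag true) (List.replicate col Γ'.ket) [] na sat posc s6) (kr KR.fl) [])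
        (dSt S oc2 md dict2 [] [] (uflag (true && bs.getD col false)) na sat posc s6) (2 * (bs.length + col) + 3) := by
      rw [update_dSt_fl]; simpa using h
    exact Runs.pop_cons (k := kr KR.fl) (a := Γ'.blank) (w := []) (by simp) hin
  | false =>
    have h := runs_clear (kr KR.c) (dSt S oc2 md dict2 (uflag false) (List.replicate col Γ'.ket) [] na sat posc s6)
    rw [dSt_c, update_dSt_c, List.length_replicate] at h
    have hin : Runs (clear (kr KR.c)) (dSt S oc2 md dict2 (uflag false) (List.replicate col Γ'.ket) [] na sat posc s6)
        (dSt S oc2 md dict2 [] [] (uflag (false && bs.getD col false)) na sat posc s6) (2 * col + 1) := h.of_eq (by simp) le_rfl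
    exact (Runs.pop_nil (by simp) hin).mono (by omega)

omit ht1 ht2 in
/-- **`popN`**: with `j` blanks in `s6` (a copy of the position counter): if `j ≥ n` reset the
position counter and increment the block counter, otherwise only empty `s6`. [folklore] -/
theorem runs_popN (oc2 md dict2 fl c u3 na : List Γ') : ∀ (n j : ℕ) (sat posc : List Γ'),
    Runs (popN n) (dSt S oc2 md dict2 fl c u3 na sat posc (List.replicate j Γ'.blank))
      (if n ≤ j then dSt S oc2 md dict2 fl c u3 na (Γ'.ket :: sat) [] [] else dSt S oc2 md dict2 fl c u3 na sat posc [])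
      (2 * n + 2 * j + 2 * posc.length + 6)
  | 0, j, sat, posc => by
    unfold popN
    rw [if_pos (Nat.zero_le _)]
    have h1 := runs_clear (kr KR.s6) (dSt S oc2 md dict2 fl c u3 na sat posc (List.replicate j Γ'.blank))
    rw [dSt_s6, update_dSt_s6, List.length_replicate] at h1
    have h2 := runs_clear (kr KR.posc) (dSt S oc2 md dict2 fl c u3 na sat posc [])
    rw [dSt_posc, update_dSt_posc] at h2
    have h3 : Runs (push (kr KR.sat) Γ'.ket) (dSt S oc2 md dict2 fl c u3 na sat [] []) (dSt S oc2 md dict2 fl c u3 na (Γ'.ket :: sat) [] []) 1 :=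
      Runs.push' (by simp)
    exact (h1.seq (h2.seq h3)).mono (by omega)
  | n + 1, 0, sat, posc => by
    unfold popN
    rw [if_neg (by omega), List.replicate_zero]
    have hin : Runs skip (dSt S oc2 md dict2 fl c u3 na sat posc []) (dSt S oc2 md dict2 fl c u3 na sat posc []) 0 := Runs.skip _
    exact (Runs.pop_nil (by simp) hin).mono (by omega)
  | n + 1, j + 1, sat, posc => by
    unfold popN
    rw [List.replicate_succ]
    have ih := runs_popN oc2 md dict2 fl c u3 na n j sat posc
    have hin : Runs (popN n) (Function.update (dSt S oc2 md dict2 fl c u3 na sat posc (Γ'.blank :: List.replicate j Γ'.blank)) (kr KR.s6)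
        (List.replicate j Γ'.blank))
        (if n + 1 ≤ j + 1 then dSt S oc2 md dict2 fl c u3 na (Γ'.ket :: sat) [] [] else dSt S oc2 md dict2 fl c u3 na sat posc [])
        (2 * n + 2 * j + 2 * posc.length + 6) := by
      rw [update_dSt_s6]
      by_cases h : n ≤ j
      · rw [if_pos h] at ih; rw [if_pos (by omega)]; exact ih
      · rw [if_neg h] at ih; rw [if_neg (by omega)]; exact ih
    exact (Runs.pop_cons (k := kr KR.s6) (a := Γ'.blank) (w := List.replicate j Γ'.blank) (by simp) hin).mono (by omega)

/-- **`wrapPos m`** after the increment of the position counter (`j + 1 ≤ m` blanks). [folklore] -/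
theorem runs_wrapPos (m : ℕ) (oc2 md dict2 fl c u3 na : List Γ') (i j : ℕ) (hj : j < m) :
    Runs (wrapPos m) (dSt S oc2 md dict2 fl c u3 na (List.replicate i Γ'.ket) (List.replicate (j + 1) Γ'.blank) [])
      (dSt S oc2 md dict2 fl c u3 na (List.replicate ((i * m + j + 1) / m) Γ'.ket) (List.replicate ((i * m + j + 1) % m) Γ'.blank) [])
      ((10 * (j + 1) + 3) + (4 * m + 2 * (j + 1) + 8)) := by
  unfold wrapPos
  have h1 := runs_copyToG (a := kr KR.posc) (b := kr KR.s6) (t₁ := kr KR.t1) (t₂ := kr KR.t2)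
    (by simp) (by simp) (by simp) (by simp) (by simp) (by simp) (dSt S oc2 md dict2 fl c u3 na (List.replicate i Γ'.ket) (List.replicate (j + 1) Γ'.blank) [])
    (by simp [ht1]) (by simp [ht2]) (by simp)
  rw [dSt_posc, update_dSt_s6, List.length_replicate] at h1
  have h2 := runs_popN S oc2 md dict2 fl c u3 na m (j + 1) (List.replicate i Γ'.ket) (List.replicate (j + 1) Γ'.blank)
  rw [List.length_replicate] at h2
  have hm : 0 < m := by omega
  by_cases h : m ≤ j + 1
  · have hjm : j + 1 = m := by omega
    rw [if_pos h] at h2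
    refine (h1.seq h2).of_eq ?_ (by omega)
    have e1 : (i * m + j + 1) / m = i + 1 := by
      rw [Nat.add_assoc, hjm, show i * m + m = (i + 1) * m by ring, Nat.mul_div_cancel _ hm]
    have e2 : (i * m + j + 1) % m = 0 := by
      rw [Nat.add_assoc, hjm, show i * m + m = (i + 1) * m by ring, Nat.mul_mod_left]
    rw [e1, e2, List.replicate_succ, List.replicate_zero]
  · rw [if_neg h] at h2
    refine (h1.seq h2).of_eq ?_ (by omega)
    have e1 : (i * m + j + 1) / m = i := by
      rw [Nat.add_assoc, Nat.add_comm, Nat.add_mul_div_right _ _ hm, Nat.div_eq_of_lt (by omega), Nat.zero_add]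
    have e2 : (i * m + j + 1) % m = j + 1 := by
      rw [Nat.add_assoc, Nat.add_comm, Nat.add_mul_mod_self_right, Nat.mod_eq_of_lt (by omega)]
    rw [e1, e2]

end DSpec

/-! ### The dictionary of a mask: the two emitters -/

/-- Push one symbol `t` onto `b` for every symbol of `a`. [folklore] -/
theorem runs_pushSym {a b : Reg} (hab : a ≠ b) (t : Γ') : ∀ (u : List Γ') (R : RStore), R a = u →
    Runs (loop a fun _ => push b t) R (Function.update (Function.update R a []) b (List.replicate u.length t ++ R b)) (3 * u.length + 1)
  | [], R, h => by
    refine (Runs.loop_nil _ h).of_eq ?_ (by simp)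
    rw [List.length_nil, List.replicate_zero, List.nil_append, Function.update_eq_self_iff.2 (by simp [hab.symm]), Function.update_eq_self_iff.2 h.symm]
  | s :: u, R, h => by
    have hb : Runs (push b t) (Function.update R a u) (Function.update (Function.update R a u) b (t :: R b)) 1 := Runs.push' (by simp [hab.symm])
    have ih := runs_pushSym hab t u (Function.update (Function.update R a u) b (t :: R b)) (by simp [hab])
    refine (Runs.loop_cons (f := fun _ => push b t) h hb ih).of_eq ?_ (by simp; omega)
    funext q
    by_cases q1 : q = b; · subst q1; simp [List.replicate_succ']
    by_cases q2 : q = a; · subst q2; simp [hab]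
    simp [q1, q2]

section Emit

variable (S : RStore) (ht1 : S (kr KR.t1) = []) (ht2 : S (kr KR.t2) = []) (hfl2 : S (kr KR.fl2) = []) (hs7 : S (kr KR.s7) = [])
include ht1 ht2 hfl2 hs7

omit hfl2 hs7 in
/-- **`emitB m`.** [folklore] -/
theorem runs_emitB (m : ℕ) (oc2 md dict2 na : List Γ') (i j : ℕ) (hj : j < m) :
    Runs (emitB m) (dSt S oc2 md dict2 [] [] [] na (List.replicate i Γ'.ket) (List.replicate j Γ'.blank) [])
      (dSt S oc2 md ((Γ'.bit true :: (List.replicate i Γ'.ket ++ List.replicate j Γ'.bra ++ [Γ'.comma]) ++ [Γ'.blank]).reverse ++ dict2) [] [] [] na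
        (List.replicate ((i * m + j + 1) / m) Γ'.ket) (List.replicate ((i * m + j + 1) % m) Γ'.blank) [])
      (13 * i + 25 * j + 4 * m + 38) := by
  unfold emitB
  set X0 := dSt S oc2 md dict2 [] [] [] na (List.replicate i Γ'.ket) (List.replicate j Γ'.blank) [] with hX0
  have h1 : Runs (push (kr KR.dict2) (Γ'.bit true)) X0 (dSt S oc2 md (Γ'.bit true :: dict2) [] [] [] na (List.replicate i Γ'.ket) (List.replicate j Γ'.blank) []) 1 :=
    Runs.push' (by simp [hX0])
  set X1 := dSt S oc2 md (Γ'.bit true :: dict2) [] [] [] na (List.replicate i Γ'.ket) (List.replicate j Γ'.blank) [] with hX1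
  have h2 := runs_copyToG (a := kr KR.sat) (b := kr KR.s6) (t₁ := kr KR.t1) (t₂ := kr KR.t2)
    (by simp) (by simp) (by simp) (by simp) (by simp) (by simp) X1 (by simp [hX1, ht1]) (by simp [hX1, ht2]) (by simp [hX1])
  rw [hX1, dSt_sat, update_dSt_s6] at h2
  have h3 := runs_moveAll (a := kr KR.s6) (b := kr KR.dict2) (by simp) (List.replicate i Γ'.ket)
    (dSt S oc2 md (Γ'.bit true :: dict2) [] [] [] na (List.replicate i Γ'.ket) (List.replicate j Γ'.blank) (List.replicate i Γ'.ket)) (by simp)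
  rw [dSt_dict2, update_dSt_s6, update_dSt_dict2, List.reverse_replicate] at h3
  set X3 := dSt S oc2 md (List.replicate i Γ'.ket ++ Γ'.bit true :: dict2) [] [] [] na (List.replicate i Γ'.ket) (List.replicate j Γ'.blank) [] with hX3
  have h4 := runs_copyToG (a := kr KR.posc) (b := kr KR.s6) (t₁ := kr KR.t1) (t₂ := kr KR.t2)
    (by simp) (by simp) (by simp) (by simp) (by simp) (by simp) X3 (by simp [hX3, ht1]) (by simp [hX3, ht2]) (by simp [hX3])
  rw [hX3, dSt_posc, update_dSt_s6] at h4
  have h5 := runs_pushSym (a := kr KR.s6) (b := kr KR.dict2) (by simp) Γ'.bra (List.replicate j Γ'.blank)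
    (dSt S oc2 md (List.replicate i Γ'.ket ++ Γ'.bit true :: dict2) [] [] [] na (List.replicate i Γ'.ket) (List.replicate j Γ'.blank) (List.replicate j Γ'.blank))
    (by simp)
  rw [dSt_dict2, update_dSt_s6, update_dSt_dict2, List.length_replicate] at h5
  set d5 := List.replicate j Γ'.bra ++ (List.replicate i Γ'.ket ++ Γ'.bit true :: dict2) with hd5
  set X5 := dSt S oc2 md d5 [] [] [] na (List.replicate i Γ'.ket) (List.replicate j Γ'.blank) [] with hX5
  have h6a : Runs (push (kr KR.dict2) Γ'.comma) X5 (dSt S oc2 md (Γ'.comma :: d5) [] [] [] na (List.replicate i Γ'.ket) (List.replicate j Γ'.blank) []) 1 :=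
    Runs.push' (by simp [hX5])
  have h6b : Runs (push (kr KR.dict2) Γ'.blank) (dSt S oc2 md (Γ'.comma :: d5) [] [] [] na (List.replicate i Γ'.ket) (List.replicate j Γ'.blank) [])
      (dSt S oc2 md (Γ'.blank :: Γ'.comma :: d5) [] [] [] na (List.replicate i Γ'.ket) (List.replicate j Γ'.blank) []) 1 := Runs.push' (by simp)
  have h6c : Runs (push (kr KR.posc) Γ'.blank) (dSt S oc2 md (Γ'.blank :: Γ'.comma :: d5) [] [] [] na (List.replicate i Γ'.ket) (List.replicate j Γ'.blank) [])
      (dSt S oc2 md (Γ'.blank :: Γ'.comma :: d5) [] [] [] na (List.replicate i Γ'.ket) (List.replicate (j + 1) Γ'.blank) []) 1 :=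
    Runs.push' (by rw [dSt_posc, update_dSt_posc, List.replicate_succ])
  have h7 := runs_wrapPos S ht1 ht2 m oc2 md (Γ'.blank :: Γ'.comma :: d5) [] [] [] na i j hj
  refine (h1.seq (h2.seq (h3.seq (h4.seq (h5.seq (h6a.seq (h6b.seq (h6c.seq h7)))))))).of_eq ?_ ?_
  · simp [hd5, List.reverse_append, List.reverse_replicate]
  · simp only [List.length_replicate]; omega

omit ht1 ht2 hfl2 hs7 in
/-- The numeral is at most the number. [folklore] -/
theorem length_bitsN_le (a : ℕ) : (bitsN a).length ≤ a := by
  simp only [List.length_map]; exact TokConv.length_encodeNat_le a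

/-- **`emitA`.** [folklore] -/
theorem runs_emitA (oc2 md dict2 sat posc : List Γ') (a : ℕ) :
    Runs emitA (dSt S oc2 md dict2 [] [] [] (bitsN a) sat posc [])
      (dSt S oc2 md ((Γ'.bit false :: (bitsN a ++ [Γ'.comma]) ++ [Γ'.blank]).reverse ++ dict2) [] [] [] (bitsN (a + 1)) sat posc [])
      (22 * (bitsN a).length + 16) := by
  unfold emitA
  set X0 := dSt S oc2 md dict2 [] [] [] (bitsN a) sat posc [] with hX0
  have h1 : Runs (push (kr KR.dict2) (Γ'.bit false)) X0 (dSt S oc2 md (Γ'.bit false :: dict2) [] [] [] (bitsN a) sat posc []) 1 :=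
    Runs.push' (by simp [hX0])
  set X1 := dSt S oc2 md (Γ'.bit false :: dict2) [] [] [] (bitsN a) sat posc [] with hX1
  have h2 := runs_copyToG (a := kr KR.na) (b := kr KR.s6) (t₁ := kr KR.t1) (t₂ := kr KR.t2)
    (by simp) (by simp) (by simp) (by simp) (by simp) (by simp) X1 (by simp [hX1, ht1]) (by simp [hX1, ht2]) (by simp [hX1])
  rw [hX1, dSt_na, update_dSt_s6] at h2
  have h3 := runs_moveAll (a := kr KR.s6) (b := kr KR.dict2) (by simp) (bitsN a)
    (dSt S oc2 md (Γ'.bit false :: dict2) [] [] [] (bitsN a) sat posc (bitsN a)) (by simp)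
  rw [dSt_dict2, update_dSt_s6, update_dSt_dict2] at h3
  set d3 := (bitsN a).reverse ++ Γ'.bit false :: dict2 with hd3
  set X3 := dSt S oc2 md d3 [] [] [] (bitsN a) sat posc [] with hX3
  have h4a : Runs (push (kr KR.dict2) Γ'.comma) X3 (dSt S oc2 md (Γ'.comma :: d3) [] [] [] (bitsN a) sat posc []) 1 := Runs.push' (by simp [hX3])
  have h4b : Runs (push (kr KR.dict2) Γ'.blank) (dSt S oc2 md (Γ'.comma :: d3) [] [] [] (bitsN a) sat posc [])
      (dSt S oc2 md (Γ'.blank :: Γ'.comma :: d3) [] [] [] (bitsN a) sat posc []) 1 := Runs.push' (by simp)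
  have h5 := runs_incrG (c := kr KR.na) (f := kr KR.fl2) (j := kr KR.s7) (by simp) (by simp) (by simp) a
    (dSt S oc2 md (Γ'.blank :: Γ'.comma :: d3) [] [] [] (bitsN a) sat posc []) (by simp) (by simp [hfl2]) (by simp [hs7])
  rw [update_dSt_na] at h5
  refine (h1.seq (h2.seq (h3.seq (h4a.seq (h4b.seq h5))))).of_eq ?_ ?_
  · simp [hd3, List.reverse_append]
  · simp only [List.length_map]; omega

end Emit

/-! ### The dictionary of a mask: counting the sides along `occList` -/

section Counting

variable (P : Params) (F : List (List (ℕ × Bool)))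

/-- The number of `A`-variables among `zs`. [folklore] -/
def cntA (zs : List ℕ) : ℕ := (zs.filter fun z => !inB P F z).length

/-- The number of `B`-variables among `zs`. [folklore] -/
def cntB (zs : List ℕ) : ℕ := (zs.filter (inB P F)).length

/-- The index of `x` in a filtered list without duplicates. [folklore] -/
theorem idxOf_filter_eq {l zs rest : List ℕ} {x : ℕ} (hl : l.Nodup) (h : l = zs ++ x :: rest) (p : ℕ → Bool) (hx : p x = true) :
    (l.filter p).idxOf x = (zs.filter p).length := by
  subst h
  have hxz : x ∉ zs := fun hm => by
    have := List.nodup_append.1 hl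
    exact (this.2.2 x hm x (by simp)) rfl
  rw [List.filter_append, List.filter_cons_of_pos hx, List.idxOf_append_of_notMem (fun hm => hxz (List.mem_of_mem_filter hm))]
  simp

/-- `inB` of an occurring variable in terms of the light flag and the mask bits. [folklore] -/
theorem inB_eq_getD (bs : List Bool) (hP : P.mask = maskOf bs) {x : ℕ} (hx : x ∈ occVars F) :
    inB P F x = (decide (occ F x ≤ P.cap) && bs.getD (col F P.cap x) false) := by
  unfold inB; rw [decide_eq_true hx, Bool.true_and, hP]; rfl

variable {zs rest : List ℕ} {x : ℕ} (hocc : occList F = zs ++ x :: rest)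
include hocc

/-- The block number of the next `B`-variable. [folklore] -/
theorem blockOf_next (hB : inB P F x = true) : blockOf P F x = cntB P F zs / bsz P := by
  unfold blockOf bList cntB; rw [idxOf_filter_eq (nodup_occList F) hocc _ hB]

/-- The position of the next `B`-variable. [folklore] -/
theorem posIn_next (hB : inB P F x = true) : posIn P F x = cntB P F zs % bsz P := by
  unfold posIn bList cntB; rw [idxOf_filter_eq (nodup_occList F) hocc _ hB]

/-- The rank of the next `A`-variable. [folklore] -/
theorem newIdxA_next (hA : inB P F x = false) : newIdxA P F x = cntA P F zs := by
  unfold newIdxA aList cntA; rw [idxOf_filter_eq (nodup_occList F) hocc _ (by simp [hA])]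

omit hocc in
/-- `cntA` after one more variable. [folklore] -/
theorem cntA_append (x : ℕ) : cntA P F (zs ++ [x]) = cntA P F zs + (if inB P F x then 0 else 1) := by
  unfold cntA; rw [List.filter_append, List.length_append]; cases h : inB P F x <;> simp [h]

omit hocc in
/-- `cntB` after one more variable. [folklore] -/
theorem cntB_append (x : ℕ) : cntB P F (zs ++ [x]) = cntB P F zs + (if inB P F x then 1 else 0) := by
  unfold cntB; rw [List.filter_append, List.length_append]; cases h : inB P F x <;> simp [h]

end Counting

/-! ### The dictionary of a mask: the pass over the occurrence records -/

/-- The per-record budget of the dictionary builder. [folklore] -/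
def dK (Lo m nb : ℕ) : ℕ := 35 * Lo + 29 * m + 2 * nb + 61

section DictSpec

variable (S : RStore) (P : Params) (F : List (List (ℕ × Bool))) (bs : List Bool) (hP : P.mask = maskOf bs)
  (ht1 : S (kr KR.t1) = []) (ht2 : S (kr KR.t2) = []) (hfl2 : S (kr KR.fl2) = []) (hs7 : S (kr KR.s7) = [])
  (Lo : ℕ) (hLo : (wRecs (ocRecs F P.cap (occList F))).length ≤ Lo)
include hP ht1 ht2 hfl2 hs7 hLo

omit hP ht1 ht2 hfl2 hs7 hLo in
/-- Key bits are copied to the output (mode empty). [folklore] -/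
theorem segRuns_d_bits (na sat posc : List Γ') : ∀ (u : List Bool) (rest d2 : List Γ'),
    SegRuns (kr KR.oc2) (dictBody bs (bsz P)) (u.map Γ'.bit) (dSt S (u.map Γ'.bit ++ rest) [] d2 [] [] [] na sat posc [])
      (dSt S rest [] ((u.map Γ'.bit).reverse ++ d2) [] [] [] na sat posc []) (5 * u.length)
  | [], rest, d2 => by simpa using SegRuns.nil (kr KR.oc2) (dictBody bs (bsz P)) _
  | d :: u, rest, d2 => by
    have hbody : Runs (dictBody bs (bsz P) (Γ'.bit d)) (Function.update (dSt S (Γ'.bit d :: (u.map Γ'.bit ++ rest)) [] d2 [] [] [] na sat posc []) (kr KR.oc2) (u.map Γ'.bit ++ rest))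
        (dSt S (u.map Γ'.bit ++ rest) [] (Γ'.bit d :: d2) [] [] [] na sat posc []) (1 + 2) := by
      rw [update_dSt_oc2]; unfold dictBody
      exact Runs.pop_nil (by simp) (Runs.push' (by simp))
    have ih := segRuns_d_bits na sat posc u rest (Γ'.bit d :: d2)
    have hk : dSt S (Γ'.bit d :: (u.map Γ'.bit ++ rest)) [] d2 [] [] [] na sat posc [] (kr KR.oc2) = Γ'.bit d :: (u.map Γ'.bit ++ rest) := by simp
    refine (SegRuns.cons hk hbody ih).cast (by simp) (by simp) (by simp) ?_
    simp only [List.length_cons]; omega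

omit hP ht1 ht2 hfl2 hs7 hLo in
/-- Colour kets go to `c` (mode `comma`). [folklore] -/
theorem segRuns_d_kets (d2 fl na sat posc : List Γ') : ∀ (n : ℕ) (rest c : List Γ'),
    SegRuns (kr KR.oc2) (dictBody bs (bsz P)) (List.replicate n Γ'.ket) (dSt S (List.replicate n Γ'.ket ++ rest) [Γ'.comma] d2 fl c [] na sat posc [])
      (dSt S rest [Γ'.comma] d2 fl (List.replicate n Γ'.ket ++ c) [] na sat posc []) (6 * n)
  | 0, rest, c => by simpa using SegRuns.nil (kr KR.oc2) (dictBody bs (bsz P)) _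
  | n + 1, rest, c => by
    have hbody : Runs (dictBody bs (bsz P) Γ'.ket) (Function.update (dSt S (Γ'.ket :: (List.replicate n Γ'.ket ++ rest)) [Γ'.comma] d2 fl c [] na sat posc []) (kr KR.oc2)
        (List.replicate n Γ'.ket ++ rest)) (dSt S (List.replicate n Γ'.ket ++ rest) [Γ'.comma] d2 fl (Γ'.ket :: c) [] na sat posc []) (2 + 2) := by
      rw [update_dSt_oc2]; unfold dictBody
      refine Runs.pop_cons (k := kr KR.md) (a := Γ'.comma) (w := []) (by simp) ?_
      rw [update_dSt_md]
      exact ((Runs.push' (R' := dSt S (List.replicate n Γ'.ket ++ rest) [] d2 fl (Γ'.ket :: c) [] na sat posc []) (by simp)).seq (Runs.push' (by simp))).of_eq rfl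
        (by norm_num)
    have ih := segRuns_d_kets d2 fl na sat posc n rest (Γ'.ket :: c)
    have hk : dSt S (Γ'.ket :: (List.replicate n Γ'.ket ++ rest)) [Γ'.comma] d2 fl c [] na sat posc [] (kr KR.oc2) = Γ'.ket :: (List.replicate n Γ'.ket ++ rest) := by simp
    refine (SegRuns.cons hk hbody ih).cast (by simp [List.replicate_succ]) (by simp [List.replicate_succ]) ?_ (by omega)
    simp [List.replicate_succ', List.append_assoc]

/-- **One occurrence record.** [folklore] -/
theorem segRuns_d_record (zs rest : List ℕ) (x : ℕ) (hocc : occList F = zs ++ x :: rest) (hcB : cntB P F zs ≤ Lo) (hcA : cntA P F zs ≤ Lo)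
    (more d2 : List Γ') :
    SegRuns (kr KR.oc2) (dictBody bs (bsz P)) (bitsN x ++ Γ'.comma :: (ocPay F P.cap x ++ [Γ'.blank]))
      (dSt S (bitsN x ++ Γ'.comma :: (ocPay F P.cap x ++ [Γ'.blank]) ++ more) [] d2 [] [] [] (bitsN (cntA P F zs))
        (List.replicate (cntB P F zs / bsz P) Γ'.ket) (List.replicate (cntB P F zs % bsz P) Γ'.blank) [])
      (dSt S more [] ((bitsN x ++ Γ'.comma :: (dpay P F x ++ [Γ'.blank])).reverse ++ d2) [] [] [] (bitsN (cntA P F (zs ++ [x])))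
        (List.replicate (cntB P F (zs ++ [x]) / bsz P) Γ'.ket) (List.replicate (cntB P F (zs ++ [x]) % bsz P) Γ'.blank) [])
      (dK Lo (bsz P) bs.length) := by
  set m := bsz P with hm
  have hm0 : 0 < m := bsz_pos P
  set a := cntA P F zs with ha
  set nb := cntB P F zs with hnb
  set i := nb / m with hi
  set j := nb % m with hj
  have hjm : j < m := Nat.mod_lt _ hm0
  have hnbij : i * m + j = nb := by rw [hi, hj, Nat.mul_comm]; exact Nat.div_add_mod nb m
  have hx : x ∈ occVars F := by rw [← mem_occList, hocc]; simp
  set light := decide (occ F x ≤ P.cap) with hlight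
  set col := col F P.cap x with hcol
  have hinB : inB P F x = (light && bs.getD col false) := inB_eq_getD P F bs hP hx
  have hxL : (bitsN x).length ≤ Lo := by
    refine le_trans ?_ hLo
    have hx' : x ∈ occList F := by rw [hocc]; simp
    obtain ⟨s₁, s₂, hs⟩ := List.append_of_mem hx'
    unfold wRecs ocRecs; rw [hs]
    simp only [List.map_append, List.map_cons, List.flatMap_append, List.flatMap_cons, List.length_append, List.length_cons, List.length_map]
    omega
  have hcolL : col ≤ Lo := by
    refine le_trans ?_ hLo
    have hx' : x ∈ occList F := by rw [hocc]; simp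
    obtain ⟨s₁, s₂, hs⟩ := List.append_of_mem hx'
    unfold wRecs ocRecs; rw [hs]
    simp only [List.map_append, List.map_cons, List.flatMap_append, List.flatMap_cons, List.length_append, List.length_cons, List.length_map,
      ocPay, List.length_replicate, hcol]
    omega
  have haL : (bitsN a).length ≤ Lo := (length_bitsN_le a).trans hcA
  have hpay : ocPay F P.cap x = Γ'.bit light :: List.replicate col Γ'.ket := rfl
  rw [hpay]
  -- 1. key bits
  have h1 := segRuns_d_bits S P bs (bitsN a) (List.replicate i Γ'.ket) (List.replicate j Γ'.blank) (encodeNat x)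
    (Γ'.comma :: (Γ'.bit light :: List.replicate col Γ'.ket ++ [Γ'.blank]) ++ more) d2
  have hrb : ((encodeNat x).map Γ'.bit).reverse = rbits x := rfl
  rw [hrb] at h1
  -- 2. comma
  have h2 : Runs (dictBody bs m Γ'.comma) (Function.update (dSt S (Γ'.comma :: (Γ'.bit light :: List.replicate col Γ'.ket ++ [Γ'.blank]) ++ more) [] (rbits x ++ d2)
      [] [] [] (bitsN a) (List.replicate i Γ'.ket) (List.replicate j Γ'.blank) []) (kr KR.oc2) (Γ'.bit light :: List.replicate col Γ'.ket ++ [Γ'.blank] ++ more))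
      (dSt S (Γ'.bit light :: List.replicate col Γ'.ket ++ [Γ'.blank] ++ more) [Γ'.comma] (Γ'.comma :: (rbits x ++ d2)) [] [] [] (bitsN a)
        (List.replicate i Γ'.ket) (List.replicate j Γ'.blank) []) ((1 + 1) + 2) := by
    rw [update_dSt_oc2]; unfold dictBody
    refine Runs.pop_nil (by simp) ?_
    exact (Runs.push' (R' := dSt S (Γ'.bit light :: List.replicate col Γ'.ket ++ [Γ'.blank] ++ more) [] (Γ'.comma :: (rbits x ++ d2)) [] [] [] (bitsN a)
      (List.replicate i Γ'.ket) (List.replicate j Γ'.blank) []) (by simp)).seq (Runs.push' (by simp))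
  -- 3. light bit
  have h3 : Runs (dictBody bs m (Γ'.bit light)) (Function.update (dSt S (Γ'.bit light :: List.replicate col Γ'.ket ++ [Γ'.blank] ++ more) [Γ'.comma]
      (Γ'.comma :: (rbits x ++ d2)) [] [] [] (bitsN a) (List.replicate i Γ'.ket) (List.replicate j Γ'.blank) []) (kr KR.oc2) (List.replicate col Γ'.ket ++ [Γ'.blank] ++ more))
      (dSt S (List.replicate col Γ'.ket ++ [Γ'.blank] ++ more) [Γ'.comma] (Γ'.comma :: (rbits x ++ d2)) (uflag light) [] [] (bitsN a)
        (List.replicate i Γ'.ket) (List.replicate j Γ'.blank) []) 4 := by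
    rw [update_dSt_oc2]; unfold dictBody
    refine Runs.pop_cons (k := kr KR.md) (a := Γ'.comma) (w := []) (by simp) ?_
    rw [update_dSt_md]
    cases light with
    | true =>
      exact (Runs.push' (R' := dSt S (List.replicate col Γ'.ket ++ [Γ'.blank] ++ more) [] (Γ'.comma :: (rbits x ++ d2)) (uflag true) [] [] (bitsN a)
        (List.replicate i Γ'.ket) (List.replicate j Γ'.blank) []) (by simp)).seq (Runs.push' (by simp))
    | false => exact (Runs.push' (by simp)).mono (by norm_num)
  -- 4. kets
  have h4 := segRuns_d_kets S P bs (Γ'.comma :: (rbits x ++ d2)) (uflag light) (bitsN a) (List.replicate i Γ'.ket) (List.replicate j Γ'.blank) col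
    ([Γ'.blank] ++ more) []
  rw [List.append_nil] at h4
  -- 5. the blank: decide and emit
  have h5 : Runs (dictBody bs m Γ'.blank) (Function.update (dSt S ([Γ'.blank] ++ more) [Γ'.comma] (Γ'.comma :: (rbits x ++ d2)) (uflag light)
      (List.replicate col Γ'.ket) [] (bitsN a) (List.replicate i Γ'.ket) (List.replicate j Γ'.blank) []) (kr KR.oc2) more)
      (dSt S more [] ((bitsN x ++ Γ'.comma :: (dpay P F x ++ [Γ'.blank])).reverse ++ d2) [] [] [] (bitsN (cntA P F (zs ++ [x])))
        (List.replicate (cntB P F (zs ++ [x]) / m) Γ'.ket) (List.replicate (cntB P F (zs ++ [x]) % m) Γ'.blank) [])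
      (((2 * (bs.length + col) + 5) + (22 * Lo + 29 * m + 40)) + 2) := by
    rw [update_dSt_oc2]; unfold dictBody
    refine Runs.pop_cons (k := kr KR.md) (a := Γ'.comma) (w := []) (by simp) ?_
    rw [update_dSt_md]; unfold recEnd
    have hd := runs_decideB S bs more [] (Γ'.comma :: (rbits x ++ d2)) (bitsN a) (List.replicate i Γ'.ket) (List.replicate j Γ'.blank) [] light col
    rw [← hinB] at hd
    refine hd.seq ?_
    rw [cntA_append, cntB_append]
    have erec : (bitsN x ++ Γ'.comma :: (dpay P F x ++ [Γ'.blank])).reverse = (dpay P F x ++ [Γ'.blank]).reverse ++ Γ'.comma :: (rbits x) := by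
      simp [rbits, List.reverse_append]
    rw [erec]
    cases hB : inB P F x with
    | true =>
      simp only [if_true, Nat.add_zero]
      have he := runs_emitB S ht1 ht2 m more [] (Γ'.comma :: (rbits x ++ d2)) (bitsN a) i j hjm
      rw [hnbij] at he
      have hdp : dpay P F x = Γ'.bit true :: (List.replicate i Γ'.ket ++ List.replicate j Γ'.bra ++ [Γ'.comma]) := by
        unfold dpay; rw [if_pos hB, blockOf_next P F hocc hB, posIn_next P F hocc hB]
      have he' : Runs (emitB m) (Function.update (dSt S more [] (Γ'.comma :: (rbits x ++ d2)) [] [] (uflag true) (bitsN a) (List.replicate i Γ'.ket)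
          (List.replicate j Γ'.blank) []) (kr KR.u3) [])
          (dSt S more [] ((dpay P F x ++ [Γ'.blank]).reverse ++ Γ'.comma :: rbits x ++ d2) [] [] [] (bitsN (cntA P F zs))
            (List.replicate ((cntB P F zs + 1) / m) Γ'.ket) (List.replicate ((cntB P F zs + 1) % m) Γ'.blank) []) (13 * i + 25 * j + 4 * m + 38) := by
        rw [update_dSt_u3]
        refine he.of_eq ?_ le_rfl
        rw [hdp]
        simp only [← ha, ← hnb]
        simp
      refine (Runs.pop_cons (k := kr KR.u3) (a := Γ'.blank) (w := []) (by simp) he').mono ?_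
      have : i ≤ Lo := le_trans (Nat.div_le_self _ _) hcB
      nlinarith
    | false =>
      simp only [Bool.false_eq_true, if_false, Nat.add_zero]
      have he := runs_emitA S ht1 ht2 hfl2 hs7 more [] (Γ'.comma :: (rbits x ++ d2)) (List.replicate i Γ'.ket) (List.replicate j Γ'.blank) a
      have hdp : dpay P F x = Γ'.bit false :: (bitsN a ++ [Γ'.comma]) := by
        unfold dpay; rw [if_neg (by simp [hB]), newIdxA_next P F hocc hB]
      have he' : Runs emitA (dSt S more [] (Γ'.comma :: (rbits x ++ d2)) [] [] (uflag false) (bitsN a) (List.replicate i Γ'.ket) (List.replicate j Γ'.blank) [])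
          (dSt S more [] ((dpay P F x ++ [Γ'.blank]).reverse ++ Γ'.comma :: rbits x ++ d2) [] [] [] (bitsN (cntA P F zs + 1))
            (List.replicate (cntB P F zs / m) Γ'.ket) (List.replicate (cntB P F zs % m) Γ'.blank) []) (22 * (bitsN a).length + 16) := by
        refine he.of_eq ?_ le_rfl
        rw [hdp]
        simp only [← ha, ← hnb, ← hi, ← hj]
        simp
      refine (Runs.pop_nil (by simp) he').mono ?_
      nlinarith
  have hk2 : dSt S (Γ'.comma :: (Γ'.bit light :: List.replicate col Γ'.ket ++ [Γ'.blank]) ++ more) [] (rbits x ++ d2) [] [] [] (bitsN a)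
      (List.replicate i Γ'.ket) (List.replicate j Γ'.blank) [] (kr KR.oc2) = Γ'.comma :: (Γ'.bit light :: List.replicate col Γ'.ket ++ [Γ'.blank] ++ more) := by simp
  have hk3 : dSt S (Γ'.bit light :: List.replicate col Γ'.ket ++ [Γ'.blank] ++ more) [Γ'.comma] (Γ'.comma :: (rbits x ++ d2)) [] [] [] (bitsN a)
      (List.replicate i Γ'.ket) (List.replicate j Γ'.blank) [] (kr KR.oc2) = Γ'.bit light :: (List.replicate col Γ'.ket ++ [Γ'.blank] ++ more) := by simp
  have hk5 : dSt S ([Γ'.blank] ++ more) [Γ'.comma] (Γ'.comma :: (rbits x ++ d2)) (uflag light) (List.replicate col Γ'.ket) [] (bitsN a)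
      (List.replicate i Γ'.ket) (List.replicate j Γ'.blank) [] (kr KR.oc2) = Γ'.blank :: more := by simp
  have h45 := h4.append (SegRuns.single hk5 h5)
  have h345 := SegRuns.cons hk3 h3 (h45.cast rfl (by simp) rfl le_rfl)
  have h2345 := SegRuns.cons hk2 h2 (h345.cast rfl (by simp) rfl le_rfl)
  have := h1.append h2345
  refine this.cast (by simp) (by simp) rfl ?_
  have hbl : (encodeNat x).length = (bitsN x).length := by simp
  rw [hbl]
  unfold dK
  nlinarith [hxL, hcolL]

end DictSpec

/-! ### The dictionary of a mask: all records -/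

section DictSpec2

variable (S : RStore) (P : Params) (F : List (List (ℕ × Bool))) (bs : List Bool) (hP : P.mask = maskOf bs)
  (ht1 : S (kr KR.t1) = []) (ht2 : S (kr KR.t2) = []) (hfl2 : S (kr KR.fl2) = []) (hs7 : S (kr KR.s7) = [])
  (Lo : ℕ) (hLo : (wRecs (ocRecs F P.cap (occList F))).length ≤ Lo)
include hP ht1 ht2 hfl2 hs7 hLo

omit hP ht1 ht2 hfl2 hs7 hLo in
/-- A table is at least as long as its key list. [folklore] -/
theorem length_le_wRecs (cap : ℕ) (L : List ℕ) : L.length ≤ (wRecs (ocRecs F cap L)).length := by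
  unfold wRecs ocRecs; rw [List.length_flatMap]
  calc L.length = (L.map fun _ => 1).sum := by simp
    _ ≤ _ := by rw [List.map_map]; exact List.sum_le_sum (fun z _ => by simp only [Function.comp_apply, List.length_append, List.length_cons, List.length_map]; omega)

/-- **The occurrence records of `ys`**, the variables `zs` done. [folklore] -/
theorem segRuns_d_records : ∀ (ys zs rest : List ℕ), occList F = zs ++ ys ++ rest → ∀ (more d2 : List Γ'),
    SegRuns (kr KR.oc2) (dictBody bs (bsz P)) (wRecs (ocRecs F P.cap ys))
      (dSt S (wRecs (ocRecs F P.cap ys) ++ more) [] d2 [] [] [] (bitsN (cntA P F zs))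
        (List.replicate (cntB P F zs / bsz P) Γ'.ket) (List.replicate (cntB P F zs % bsz P) Γ'.blank) [])
      (dSt S more [] ((wRecs (dictRecs P F ys)).reverse ++ d2) [] [] [] (bitsN (cntA P F (zs ++ ys)))
        (List.replicate (cntB P F (zs ++ ys) / bsz P) Γ'.ket) (List.replicate (cntB P F (zs ++ ys) % bsz P) Γ'.blank) [])
      (dK Lo (bsz P) bs.length * ys.length)
  | [], zs, rest, _, more, d2 => by
    simpa [wRecs, ocRecs, dictRecs] using SegRuns.nil (kr KR.oc2) (dictBody bs (bsz P)) _
  | x :: ys, zs, rest, hocc, more, d2 => by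
    have hocc' : occList F = zs ++ x :: (ys ++ rest) := by rw [hocc]; simp
    have hzs : zs.length ≤ Lo := by
      refine le_trans ?_ ((length_le_wRecs F P.cap (occList F)).trans hLo)
      rw [hocc']; simp
    have hcB : cntB P F zs ≤ Lo := (List.length_filter_le _ _).trans hzs
    have hcA : cntA P F zs ≤ Lo := (List.length_filter_le _ _).trans hzs
    have h1 := segRuns_d_record S P F bs hP ht1 ht2 hfl2 hs7 Lo hLo zs (ys ++ rest) x hocc' hcB hcA (wRecs (ocRecs F P.cap ys) ++ more) d2
    have h2 := segRuns_d_records ys (zs ++ [x]) rest (by rw [hocc]; simp) more ((bitsN x ++ Γ'.comma :: (dpay P F x ++ [Γ'.blank])).reverse ++ d2)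
    have := h1.append h2
    refine this.cast (by simp [wRecs, ocRecs]) (by simp [wRecs, ocRecs]) ?_ ?_
    · simp [wRecs, dictRecs, List.reverse_append]
    · simp only [List.length_cons]; ring_nf; omega

omit hP ht1 ht2 hfl2 hs7 in
/-- The dictionary is at most `Lo (2 Lo + m + 4)` symbols long. [folklore] -/
theorem length_wRecs_dictRecs_le : (wRecs (dictRecs P F (occList F))).length ≤ Lo * (2 * Lo + bsz P + 4) := by
  have hocc : (occList F).length ≤ Lo := (length_le_wRecs F P.cap (occList F)).trans hLo
  have hrec : ∀ x ∈ occList F, ((encodeNat x).map Γ'.bit ++ Γ'.comma :: (dpay P F x ++ [Γ'.blank])).length ≤ 2 * Lo + bsz P + 4 := by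
    intro x hx
    have hxL : (encodeNat x).length ≤ Lo := by
      refine le_trans ?_ hLo
      obtain ⟨s₁, s₂, hs⟩ := List.append_of_mem hx
      unfold wRecs ocRecs; rw [hs]
      simp only [List.map_append, List.map_cons, List.flatMap_append, List.flatMap_cons, List.length_append, List.length_cons, List.length_map]
      omega
    have hdp : (dpay P F x).length ≤ Lo + bsz P + 2 := by
      unfold dpay
      split_ifs with hB
      · have hi : blockOf P F x ≤ Lo := by
          unfold blockOf
          refine (Nat.div_le_self _ _).trans ((List.idxOf_le_length).trans ?_)
          exact (List.length_filter_le _ _).trans hocc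
        have hj : posIn P F x < bsz P := Nat.mod_lt _ (bsz_pos P)
        simp only [List.length_cons, List.length_append, List.length_replicate, List.length_nil]; omega
      · have ha : (encodeNat (newIdxA P F x)).length ≤ Lo := by
          refine (TokConv.length_encodeNat_le _).trans ?_
          unfold newIdxA
          exact (List.idxOf_le_length).trans ((List.length_filter_le _ _).trans hocc)
        simp only [List.length_cons, List.length_append, List.length_map, List.length_nil]; omega
    simp only [List.length_append, List.length_map, List.length_cons, List.length_nil]; omega
  unfold wRecs dictRecs
  rw [List.length_flatMap, List.map_map]
  calc ((occList F).map _).sum ≤ ((occList F).map fun _ => 2 * Lo + bsz P + 4).sum :=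
        List.sum_le_sum (fun x hx => hrec x hx)
    _ = (occList F).length * (2 * Lo + bsz P + 4) := by rw [List.map_const', List.sum_replicate, smul_eq_mul]
    _ ≤ _ := Nat.mul_le_mul_right _ hocc

/-- The cost of the dictionary builder. [folklore] -/
def dictCost (Lo m nb : ℕ) : ℕ := (10 * Lo + 3) + (dK Lo m nb * Lo + 1) + (3 * (Lo * (2 * Lo + m + 4)) + 1) + (2 * Lo + 1) + (2 * Lo + 1) + (2 * m + 1)

/-- **Specification of `dictBuild`.** [folklore] -/
theorem runs_dictBuild (hoc : S (kr KR.oc) = wRecs (ocRecs F P.cap (occList F))) (hoc2 : S (kr KR.oc2) = []) (hmd : S (kr KR.md) = [])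
    (hd2 : S (kr KR.dict2) = []) (hfl : S (kr KR.fl) = []) (hc : S (kr KR.c) = []) (hu3 : S (kr KR.u3) = []) (hna : S (kr KR.na) = [])
    (hsat : S (kr KR.sat) = []) (hposc : S (kr KR.posc) = []) (hs6 : S (kr KR.s6) = []) (hdict : S (kr KR.dict) = []) :
    Runs (dictBuild bs (bsz P)) S (Function.update (Function.update S (kr KR.na) (bitsN (cntA P F (occList F)))) (kr KR.dict) (wRecs (dictRecs P F (occList F))))
      (dictCost Lo (bsz P) bs.length) := by
  have e0 : dSt S [] [] [] [] [] [] (bitsN 0) [] [] [] = S := by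
    have e := dSt_eta S
    rw [hoc2, hmd, hd2, hfl, hc, hu3, hna, hsat, hposc, hs6] at e
    exact e
  have hoccL : (occList F).length ≤ Lo := (length_le_wRecs F P.cap (occList F)).trans hLo
  unfold dictBuild
  have h0 := runs_copyToG (a := kr KR.oc) (b := kr KR.oc2) (t₁ := kr KR.t1) (t₂ := kr KR.t2)
    (by simp) (by simp) (by simp) (by simp) (by simp) (by simp) (dSt S [] [] [] [] [] [] (bitsN 0) [] [] []) (by simp [ht1]) (by simp [ht2]) (by simp)
  rw [dSt_oc, hoc, update_dSt_oc2] at h0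
  have h1 := (segRuns_d_records S P F bs hP ht1 ht2 hfl2 hs7 Lo hLo (occList F) [] [] (by simp) [] []).runs_loop_nil (by simp)
  simp only [List.append_nil, List.nil_append, cntB, List.filter_nil, List.length_nil, Nat.zero_div, Nat.zero_mod, List.replicate_zero] at h1
  rw [show cntA P F [] = 0 from rfl] at h1
  set A := cntA P F (occList F) with hA
  set B := (List.filter (inB P F) (occList F)).length with hB
  set X1 := dSt S [] [] (wRecs (dictRecs P F (occList F))).reverse [] [] [] (bitsN A) (List.replicate (B / bsz P) Γ'.ket) (List.replicate (B % bsz P) Γ'.blank) []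
    with hX1
  have h2 := runs_pour (a := kr KR.dict2) (b := kr KR.dict) (by simp) X1
  rw [hX1, dSt_dict2, dSt_dict, hdict, List.append_nil, List.reverse_reverse, List.length_reverse, update_dSt_dict2] at h2
  set X2 := Function.update (dSt S [] [] [] [] [] [] (bitsN A) (List.replicate (B / bsz P) Γ'.ket) (List.replicate (B % bsz P) Γ'.blank) []) (kr KR.dict)
    (wRecs (dictRecs P F (occList F))) with hX2
  have h4 := runs_clear (kr KR.sat) X2
  have e4 : X2 (kr KR.sat) = List.replicate (B / bsz P) Γ'.ket := by simp [hX2]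
  rw [e4, List.length_replicate] at h4
  have h5 := runs_clear (kr KR.posc) (Function.update X2 (kr KR.sat) [])
  have e5 : Function.update X2 (kr KR.sat) [] (kr KR.posc) = List.replicate (B % bsz P) Γ'.blank := by simp [hX2]
  rw [e5, List.length_replicate] at h5
  rw [e0] at h0
  refine (h0.seq (h1.seq (h2.seq (h4.seq h5)))).of_eq ?_ ?_
  · rw [hX2]
    funext q
    by_cases q1 : q = kr KR.posc; · subst q1; simp [hposc]
    rw [Function.update_of_ne q1]
    by_cases q2 : q = kr KR.sat; · subst q2; simp [hsat]
    rw [Function.update_of_ne q2]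
    by_cases q4 : q = kr KR.dict; · subst q4; simp
    rw [Function.update_of_ne q4, Function.update_of_ne q4]
    by_cases q3 : q = kr KR.na; · subst q3; simp
    rw [Function.update_of_ne q3]
    by_cases g1 : q = kr KR.oc2; · subst g1; simp [hoc2]
    by_cases g2 : q = kr KR.md; · subst g2; simp [hmd]
    by_cases g3 : q = kr KR.dict2; · subst g3; simp [hd2]
    by_cases g4 : q = kr KR.fl; · subst g4; simp [hfl]
    by_cases g5 : q = kr KR.c; · subst g5; simp [hc]
    by_cases g6 : q = kr KR.u3; · subst g6; simp [hu3]
    by_cases g7 : q = kr KR.s6; · subst g7; simp [hs6]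
    rw [dSt_other _ _ _ _ _ _ _ _ _ _ _ g1 g2 g3 g4 g5 g6 q3 q2 q1 g7]
  · have hl := length_wRecs_dictRecs_le P F Lo hLo
    have hBL : B / bsz P ≤ Lo := (Nat.div_le_self _ _).trans ((List.length_filter_le _ _).trans hoccL)
    have hBm : B % bsz P < bsz P := Nat.mod_lt _ (bsz_pos P)
    have hdk : dK Lo (bsz P) bs.length * (occList F).length ≤ dK Lo (bsz P) bs.length * Lo := Nat.mul_le_mul_left _ hoccL
    unfold dictCost
    omega

end DictSpec2

end Literature.Computability.FineGrained.IPRenameM
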